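import Summits.ValiantsHypothesis.ValiantsHypothesis.Theorems.BarrierLeverAnchoredDoorHitsLowerPairsStarTwoCentre

/-!
# Route BarrierLever — support item `AnchoredDoorHitsLowerPairs` (stmt-ValiantsHypothesis-22510), line `anchored_peeling`:
# TWO-CENTRE 0/1 DESIGNS: the star-forest block of a face-rich pair reduces to an `ε × ε` NATURAL-NUMBER matrix

Helper file (`--supports stmt-ValiantsHypothesis-22510`; val-np-p1 g34). Door slot of record `Stmt.conjStarLower`; residual of
record after …StarVertexRich / …StarTwoCentre: FACE-RICH pairs (`ε := r − 1 − n₁ − n₂ ≥ 1`). Closes NO item; nothing here bears on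
crux 14610 or on `VP ≠ VNP`, which is NOT proved.

THE DEVICE. A TWO-CENTRE DESIGN of an injective lower pair `(u, w)` consists of: an UP-CLOSED set `𝓐*` of `ε` big row faces
(`A ∈ 𝓐*`, `A ⊆ u i'` ⇒ `i' ∈ 𝓐*`) and an up-closed set `𝓢*` of `ε` big column faces; a bijection `α` from the column vertices onto
the big row faces outside `𝓐*` (possible exactly when `#big row faces − ε = n₂`, i.e. on face-rich pairs) and a bijection `β` from the row
vertices onto the big column faces outside `𝓢*`; a bijection `γ : 𝓐* ≃ 𝓢*`. Put the 0/1 weights `ḡ b e = [b ∈ u(α e)]`,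
`d̄ b e = [e ∈ w(β b)]` (the column vertex `e` SITS ON the row face `α e`, the row vertex `b` on the column face `β b`). Then in the
two-centre matrix (…StarTwoCentre): `[A, e] = [A ⊆ u(α e)]`, `[b, S] = [S ⊆ w(β b)]`, vertex × vertex `= 0`, and by up-closedness
`[A*, e] = 0`, `[b, S*] = 0` for `A* ∈ 𝓐*`, `S* ∈ 𝓢*`. After the column permutation matching (big rows ∉ 𝓐* ↔ column vertices via α),
(`𝓐*` ↔ `𝓢*` via γ), (row vertices ↔ big columns ∉ 𝓢* via β), (∅ ↔ ∅), the two-centre matrix is BLOCK-TRIANGULAR with diagonal blocks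
two INCLUSION MATRICES of injective set families (determinant 1, `ProductStateSums.det_inclusionMatrix`), `(1)`, and the `ε × ε` DESIGN MATRIX
`B[A*, S*] = twoTop ḡ d̄ (u A*) (w (γ S*))` — a matrix of NATURAL NUMBERS; **THEOREM (…DesignDet): `det B ≠ 0` ⇒ STAR-GOOD.**
-/

set_option linter.dupNamespace false

namespace Summit.ValiantsHypothesis.ValiantsHypothesis.Theorems.BarrierLever.AnchoredPeeling

open Finset
open Summit.ValiantsHypothesis.ValiantsHypothesis.Theorems.BarrierLever.ProductStateSums (det_inclusionMatrix)

noncomputable section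

namespace StarDoor

variable {K : Type*} [CommRing K] {h : ℕ}

/-! ## 1. More entries of the two-centre matrix -/

section Entries

variable (gb db : Fin h → Fin h → K)

/-- Where the two potentials agree, `twoTop = oneTop`. -/
theorem twoTop_eq_oneTop {A S : Finset (Fin h)} (hpot : tcPot A S = scPot A S) : twoTop gb db A S = oneTop gb db A S := by
  unfold twoTop oneTop; simp_rw [hpot]

/-- The empty row of the two-centre matrix: `[S = ∅]`. -/
theorem twoTop_empty_left (S : Finset (Fin h)) : twoTop gb db ∅ S = if S = ∅ then 1 else 0 := by
  classical
  by_cases hS2 : 2 ≤ S.card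
  · -- all column vertices would be isolated centres: `|S| ≥ 2` centres, potential `|S| - 1`
    have hne : S ≠ ∅ := fun h0 => by rw [h0, Finset.card_empty] at hS2; omega
    rw [if_neg hne]
    unfold twoTop
    rw [Finset.powerset_empty, Finset.sum_singleton]
    refine Finset.sum_eq_zero fun S' hS' => ?_
    have hS'S : S' ⊆ S := Finset.mem_powerset.mp hS'
    split_ifs with hdeg
    · refine scCoef_eq_zero_of_col gb db ?_ rfl
      have hdeg' : (S \ S').card = S.card - 1 := by
        unfold scDeg tcPot bigInd at hdeg; simp [hS2] at hdeg; omega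
      rw [← Finset.card_pos, hdeg']; omega
    · rfl
  · rw [twoTop_eq_oneTop gb db (by unfold tcPot scPot bigInd; simp [hS2]), oneTop_empty_left]

/-- Vertex against vertex: no two-centre forest of top degree (`0`). -/
theorem twoTop_card_one_card_one {A S : Finset (Fin h)} (hA : A.card = 1) (hS : S.card = 1) : twoTop gb db A S = 0 := by
  classical
  unfold twoTop
  refine Finset.sum_eq_zero fun A' hA' => Finset.sum_eq_zero fun S' hS' => ?_
  have hA'A : A' ⊆ A := Finset.mem_powerset.mp hA'
  have hS'S : S' ⊆ S := Finset.mem_powerset.mp hS'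
  split_ifs with hdeg
  · -- top degree `2` forces `A' = S' = ∅`, and then the summand vanishes
    unfold scDeg tcPot bigInd at hdeg
    rw [Finset.card_sdiff_of_subset hA'A, Finset.card_sdiff_of_subset hS'S, hA, hS] at hdeg
    simp at hdeg
    have hA'0 : A' = ∅ := Finset.card_eq_zero.mp (by omega)
    refine scCoef_eq_zero_of_col gb db ?_ hA'0
    rw [← Finset.card_pos, Finset.card_sdiff_of_subset hS'S, hS]; omega
  · rfl

/-- Vertex row against a big column: `∏ d̄`. -/
theorem twoTop_card_one_left {A S : Finset (Fin h)} (hA : A.card = 1) (hS : 2 ≤ S.card) :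
    twoTop gb db A S = ∏ b ∈ A, ∏ e ∈ S, db b e := by
  rw [twoTop_eq_oneTop gb db (by unfold tcPot scPot bigInd; simp [hA, hS]; omega), oneTop_card_one_left gb db hA hS]

/-- Big row against a vertex column: `∏ ḡ`. -/
theorem twoTop_card_one_right {A S : Finset (Fin h)} (hA : 2 ≤ A.card) (hS : S.card = 1) :
    twoTop gb db A S = ∏ e ∈ S, ∏ b ∈ A, gb b e := by
  rw [twoTop_eq_oneTop gb db (by unfold tcPot scPot bigInd; simp [hA, hS]), oneTop_card_one_right gb db hA hS]

end Entries

/-! ## 2. Two-centre designs -/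

section Design

variable {r : ℕ} (u w : Fin r → Finset (Fin h))

/-- Seating weights, row-leaf side: `ḡ b e = [b ∈ u(αf e)]` for a seating `αf` of the column vertices on row faces. -/
def seatG (αf : {j : Fin r // (w j).card = 1} → Fin r) (K : Type*) [CommRing K] (b e : Fin h) : K :=
  if ∃ j : {j : Fin r // (w j).card = 1}, w j.1 = {e} ∧ b ∈ u (αf j) then 1 else 0

/-- Seating weights, column-leaf side: `d̄ b e = [e ∈ w(βf b)]`. -/
def seatD (βf : {i : Fin r // (u i).card = 1} → Fin r) (K : Type*) [CommRing K] (b e : Fin h) : K :=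
  if ∃ i : {i : Fin r // (u i).card = 1}, u i.1 = {b} ∧ e ∈ w (βf i) then 1 else 0

/-- **A two-centre 0/1 design** of a face-rich pair: up-closed sets `𝓐*`, `𝓢*` of big faces, the seating `α` of the column vertices on
the other big row faces, the seating `β` of the row vertices on the other big column faces, and a pairing `γ : 𝓐* ≃ 𝓢*`. -/
structure TCDesign where
  /-- the excess row faces `𝓐*` (indices) -/
  Astar : Finset (Fin r)
  /-- the excess column faces `𝓢*` (indices) -/
  Sstar : Finset (Fin r)
  big_A : ∀ i ∈ Astar, 2 ≤ (u i).card
  big_S : ∀ j ∈ Sstar, 2 ≤ (w j).card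
  up_A : ∀ i ∈ Astar, ∀ i', u i ⊆ u i' → i' ∈ Astar
  up_S : ∀ j ∈ Sstar, ∀ j', w j ⊆ w j' → j' ∈ Sstar
  /-- column vertex ↦ the big row face (outside `𝓐*`) it sits on -/
  α : {j : Fin r // (w j).card = 1} ≃ {i : Fin r // 2 ≤ (u i).card ∧ i ∉ Astar}
  /-- row vertex ↦ the big column face (outside `𝓢*`) it sits on -/
  β : {i : Fin r // (u i).card = 1} ≃ {j : Fin r // 2 ≤ (w j).card ∧ j ∉ Sstar}
  /-- the pairing of the excess faces -/
  γ : {i : Fin r // i ∈ Astar} ≃ {j : Fin r // j ∈ Sstar}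
  hZr : (univ.filter fun i => (u i).card = 0).card = 1
  hZc : (univ.filter fun j => (w j).card = 0).card = 1

namespace TCDesign

variable {u w} (D : TCDesign u w)

/-- Design row-leaf weights: `ḡ b e = [b ∈ u(α e)]`. -/
def gD (K : Type*) [CommRing K] (b e : Fin h) : K := seatG u w (fun j => (D.α j).1) K b e

/-- Design column-leaf weights: `d̄ b e = [e ∈ w(β b)]`. -/
def dD (K : Type*) [CommRing K] (b e : Fin h) : K := seatD u w (fun i => (D.β i).1) K b e

/-- The design weights are the images of the integer design weights. -/
theorem cast_gD (K : Type*) [CommRing K] (b e : Fin h) : ((D.gD ℤ b e : ℤ) : K) = D.gD K b e := by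
  unfold gD seatG; split_ifs <;> simp

/-- The design weights are the images of the integer design weights. -/
theorem cast_dD (K : Type*) [CommRing K] (b e : Fin h) : ((D.dD ℤ b e : ℤ) : K) = D.dD K b e := by
  unfold dD seatD; split_ifs <;> simp

/-- `ḡ` on the vertex of column `j`: membership in `u (α j)`. -/
theorem gD_of (K : Type*) [CommRing K] (hw : Function.Injective w) (j : {j : Fin r // (w j).card = 1}) {e : Fin h}
    (he : w j.1 = {e}) (b : Fin h) : D.gD K b e = if b ∈ u (D.α j).1 then 1 else 0 := by
  unfold gD seatG
  have hex : (∃ j' : {j : Fin r // (w j).card = 1}, w j'.1 = {e} ∧ b ∈ u (D.α j').1) ↔ b ∈ u (D.α j).1 := by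
    constructor
    · rintro ⟨j', hj', hb⟩
      have : j' = j := Subtype.ext (hw (hj'.trans he.symm))
      rw [this] at hb; exact hb
    · intro hb; exact ⟨j, he, hb⟩
  simp only [hex]

/-- `d̄` on the vertex of row `i`: membership in `w (β i)`. -/
theorem dD_of (K : Type*) [CommRing K] (hu : Function.Injective u) (i : {i : Fin r // (u i).card = 1}) {b : Fin h}
    (hb : u i.1 = {b}) (e : Fin h) : D.dD K b e = if e ∈ w (D.β i).1 then 1 else 0 := by
  unfold dD seatD
  have hex : (∃ i' : {i : Fin r // (u i).card = 1}, u i'.1 = {b} ∧ e ∈ w (D.β i').1) ↔ e ∈ w (D.β i).1 := by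
    constructor
    · rintro ⟨i', hi', he⟩
      have : i' = i := Subtype.ext (hu (hi'.trans hb.symm))
      rw [this] at he; exact he
    · intro he; exact ⟨i, hb, he⟩
  simp only [hex]

/-- **Entry: big row `i` against the vertex column `j`** = `[u i ⊆ u (α j)]`. -/
theorem twoTop_big_vertex (K : Type*) [CommRing K] (hw : Function.Injective w) {i : Fin r} (hi : 2 ≤ (u i).card)
    (j : {j : Fin r // (w j).card = 1}) :
    twoTop (D.gD K) (D.dD K) (u i) (w j.1) = if u i ⊆ u (D.α j).1 then 1 else 0 := by
  classical
  obtain ⟨e, he⟩ := Finset.card_eq_one.mp j.2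
  rw [twoTop_card_one_right _ _ hi j.2, he, Finset.prod_singleton]
  simp_rw [D.gD_of K hw j he]
  rw [Finset.prod_boole]
  by_cases hs : u i ⊆ u (D.α j).1
  · rw [if_pos hs, if_pos (show ∀ b ∈ u i, b ∈ u (D.α j).1 from fun b hb => hs hb)]
  · rw [if_neg hs, if_neg (show ¬ ∀ b ∈ u i, b ∈ u (D.α j).1 from fun h' => hs fun b hb => h' b hb)]

/-- **Entry: vertex row `i` against the big column `j`** = `[w j ⊆ w (β i)]`. -/
theorem twoTop_vertex_big (K : Type*) [CommRing K] (hu : Function.Injective u) (i : {i : Fin r // (u i).card = 1})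
    {j : Fin r} (hj : 2 ≤ (w j).card) :
    twoTop (D.gD K) (D.dD K) (u i.1) (w j) = if w j ⊆ w (D.β i).1 then 1 else 0 := by
  classical
  obtain ⟨b, hb⟩ := Finset.card_eq_one.mp i.2
  rw [twoTop_card_one_left _ _ i.2 hj, hb, Finset.prod_singleton]
  simp_rw [D.dD_of K hu i hb]
  rw [Finset.prod_boole]
  by_cases hs : w j ⊆ w (D.β i).1
  · rw [if_pos hs, if_pos (show ∀ e ∈ w j, e ∈ w (D.β i).1 from fun e he => hs he)]
  · rw [if_neg hs, if_neg (show ¬ ∀ e ∈ w j, e ∈ w (D.β i).1 from fun h' => hs fun e he => h' e he)]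

/-! ### The classes and the column permutation -/
/-- Row classes: big `∉ 𝓐*` ↦ 0, `𝓐*` ↦ 1, vertices ↦ 2, `∅` ↦ 3. -/
def rt (i : Fin r) : ℕ := if i ∈ D.Astar then 1 else if 2 ≤ (u i).card then 0 else if (u i).card = 1 then 2 else 3
/-- Column classes numbered by the partner row class: vertices ↦ 0, `𝓢*` ↦ 1, big `∉ 𝓢*` ↦ 2, `∅` ↦ 3. -/
def ct (j : Fin r) : ℕ := if j ∈ D.Sstar then 1 else if 2 ≤ (w j).card then 2 else if (w j).card = 1 then 0 else 3

/-- The four row cases with their class values. -/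
theorem rt_cases (i : Fin r) :
    (i ∈ D.Astar ∧ D.rt i = 1) ∨ (2 ≤ (u i).card ∧ i ∉ D.Astar ∧ D.rt i = 0) ∨
      ((u i).card = 1 ∧ D.rt i = 2) ∨ ((u i).card = 0 ∧ D.rt i = 3) := by
  unfold rt
  by_cases h1 : i ∈ D.Astar
  · exact Or.inl ⟨h1, by rw [if_pos h1]⟩
  by_cases h2 : 2 ≤ (u i).card
  · exact Or.inr (Or.inl ⟨h2, h1, by rw [if_neg h1, if_pos h2]⟩)
  by_cases h3 : (u i).card = 1
  · exact Or.inr (Or.inr (Or.inl ⟨h3, by rw [if_neg h1, if_neg h2, if_pos h3]⟩))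
  · exact Or.inr (Or.inr (Or.inr ⟨by omega, by rw [if_neg h1, if_neg h2, if_neg h3]⟩))

/-- The four column cases with their class values. -/
theorem ct_cases (j : Fin r) :
    (j ∈ D.Sstar ∧ D.ct j = 1) ∨ (2 ≤ (w j).card ∧ j ∉ D.Sstar ∧ D.ct j = 2) ∨
      ((w j).card = 1 ∧ D.ct j = 0) ∨ ((w j).card = 0 ∧ D.ct j = 3) := by
  unfold ct
  by_cases h1 : j ∈ D.Sstar
  · exact Or.inl ⟨h1, by rw [if_pos h1]⟩
  by_cases h2 : 2 ≤ (w j).card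
  · exact Or.inr (Or.inl ⟨h2, h1, by rw [if_neg h1, if_pos h2]⟩)
  by_cases h3 : (w j).card = 1
  · exact Or.inr (Or.inr (Or.inl ⟨h3, by rw [if_neg h1, if_neg h2, if_pos h3]⟩))
  · exact Or.inr (Or.inr (Or.inr ⟨by omega, by rw [if_neg h1, if_neg h2, if_neg h3]⟩))
/-- Row class `0` = big faces outside `𝓐*`. -/
theorem rt_eq_zero_iff (i : Fin r) : D.rt i = 0 ↔ 2 ≤ (u i).card ∧ i ∉ D.Astar := by
  have hbig := D.big_A i
  rcases D.rt_cases i with ⟨h, hv⟩ | ⟨h, h', hv⟩ | ⟨h, hv⟩ | ⟨h, hv⟩ <;> rw [hv]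
  · constructor
    · intro hh; omega
    · rintro ⟨_, hn⟩; exact absurd h hn
  · simp [h, h']
  · constructor
    · intro hh; omega
    · rintro ⟨h2, _⟩; omega
  · constructor
    · intro hh; omega
    · rintro ⟨h2, _⟩; omega
/-- Row class `1` = `𝓐*`. -/
theorem rt_eq_one_iff (i : Fin r) : D.rt i = 1 ↔ i ∈ D.Astar := by
  have hbig := D.big_A i
  rcases D.rt_cases i with ⟨h, hv⟩ | ⟨h, h', hv⟩ | ⟨h, hv⟩ | ⟨h, hv⟩ <;> rw [hv]
  · simp [h]
  · simp [h']
  · constructor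
    · intro hh; omega
    · intro hh; have := hbig hh; omega
  · constructor
    · intro hh; omega
    · intro hh; have := hbig hh; omega
/-- Row class `2` = vertices. -/
theorem rt_eq_two_iff (i : Fin r) : D.rt i = 2 ↔ (u i).card = 1 := by
  have hbig := D.big_A i
  rcases D.rt_cases i with ⟨h, hv⟩ | ⟨h, h', hv⟩ | ⟨h, hv⟩ | ⟨h, hv⟩ <;> rw [hv] <;> constructor <;> intro hh <;>
    first | omega | rfl | skip
  · have := hbig h; omega
/-- Row class `3` = the empty face. -/
theorem rt_eq_three_iff (i : Fin r) : D.rt i = 3 ↔ (u i).card = 0 := by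
  have hbig := D.big_A i
  rcases D.rt_cases i with ⟨h, hv⟩ | ⟨h, h', hv⟩ | ⟨h, hv⟩ | ⟨h, hv⟩ <;> rw [hv] <;> constructor <;> intro hh <;>
    first | omega | rfl | skip
  · have := hbig h; omega
/-- Row classes are `≤ 3`. -/
theorem rt_le_three (i : Fin r) : D.rt i ≤ 3 := by unfold rt; split_ifs <;> omega
/-- Column class `0` = vertices. -/
theorem ct_eq_zero_iff (j : Fin r) : D.ct j = 0 ↔ (w j).card = 1 := by
  have hbig := D.big_S j
  rcases D.ct_cases j with ⟨h, hv⟩ | ⟨h, h', hv⟩ | ⟨h, hv⟩ | ⟨h, hv⟩ <;> rw [hv] <;> constructor <;> intro hh <;>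
    first | omega | rfl | skip
  · have := hbig h; omega
/-- Column class `1` = `𝓢*`. -/
theorem ct_eq_one_iff (j : Fin r) : D.ct j = 1 ↔ j ∈ D.Sstar := by
  have hbig := D.big_S j
  rcases D.ct_cases j with ⟨h, hv⟩ | ⟨h, h', hv⟩ | ⟨h, hv⟩ | ⟨h, hv⟩ <;> rw [hv]
  · simp [h]
  · simp [h']
  · constructor
    · intro hh; omega
    · intro hh; have := hbig hh; omega
  · constructor
    · intro hh; omega
    · intro hh; have := hbig hh; omega
/-- Column class `2` = big faces outside `𝓢*`. -/
theorem ct_eq_two_iff (j : Fin r) : D.ct j = 2 ↔ 2 ≤ (w j).card ∧ j ∉ D.Sstar := by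
  have hbig := D.big_S j
  rcases D.ct_cases j with ⟨h, hv⟩ | ⟨h, h', hv⟩ | ⟨h, hv⟩ | ⟨h, hv⟩ <;> rw [hv]
  · constructor
    · intro hh; omega
    · rintro ⟨_, hn⟩; exact absurd h hn
  · simp [h, h']
  · constructor
    · intro hh; omega
    · rintro ⟨h2, _⟩; omega
  · constructor
    · intro hh; omega
    · rintro ⟨h2, _⟩; omega
/-- Column class `3` = the empty face. -/
theorem ct_eq_three_iff (j : Fin r) : D.ct j = 3 ↔ (w j).card = 0 := by
  have hbig := D.big_S j
  rcases D.ct_cases j with ⟨h, hv⟩ | ⟨h, h', hv⟩ | ⟨h, hv⟩ | ⟨h, hv⟩ <;> rw [hv] <;> constructor <;> intro hh <;>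
    first | omega | rfl | skip
  · have := hbig h; omega
/-- Column classes are `≤ 3`. -/
theorem ct_le_three (j : Fin r) : D.ct j ≤ 3 := by unfold ct; split_ifs <;> omega

/-- Class 0 of the rows ≃ class 0 of the columns, through `α⁻¹`. -/
def fiber0 : {i : Fin r // D.rt i = 0} ≃ {j : Fin r // D.ct j = 0} :=
  ((Equiv.subtypeEquivRight fun i => D.rt_eq_zero_iff i).trans D.α.symm).trans
    (Equiv.subtypeEquivRight fun j => (D.ct_eq_zero_iff j).symm)

/-- Class 1 ≃ class 1, through `γ`. -/
def fiber1 : {i : Fin r // D.rt i = 1} ≃ {j : Fin r // D.ct j = 1} :=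
  ((Equiv.subtypeEquivRight fun i => D.rt_eq_one_iff i).trans D.γ).trans
    (Equiv.subtypeEquivRight fun j => (D.ct_eq_one_iff j).symm)

/-- Class 2 ≃ class 2, through `β`. -/
def fiber2 : {i : Fin r // D.rt i = 2} ≃ {j : Fin r // D.ct j = 2} :=
  ((Equiv.subtypeEquivRight fun i => D.rt_eq_two_iff i).trans D.β).trans
    (Equiv.subtypeEquivRight fun j => (D.ct_eq_two_iff j).symm)

/-- The classes `≥ 3` have equal sizes (one empty face on each side; nothing above 3). -/
theorem card_fiber_ge_three {k : ℕ} (hk : 3 ≤ k) : Fintype.card {i : Fin r // D.rt i = k} = Fintype.card {j : Fin r // D.ct j = k} := by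
  classical
  rw [Fintype.card_subtype, Fintype.card_subtype]
  by_cases h3 : k = 3
  · subst h3
    have e1 : (univ.filter fun i => D.rt i = 3) = univ.filter fun i => (u i).card = 0 := by
      ext i; simp only [Finset.mem_filter, Finset.mem_univ, true_and]; exact D.rt_eq_three_iff i
    have e2 : (univ.filter fun j => D.ct j = 3) = univ.filter fun j => (w j).card = 0 := by
      ext j; simp only [Finset.mem_filter, Finset.mem_univ, true_and]; exact D.ct_eq_three_iff j
    rw [e1, e2, D.hZr, D.hZc]
  · have e1 : (univ.filter fun i => D.rt i = k) = ∅ := by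
      ext i; simp only [Finset.mem_filter, Finset.mem_univ, true_and, Finset.notMem_empty, iff_false]
      have := D.rt_le_three i; omega
    have e2 : (univ.filter fun j => D.ct j = k) = ∅ := by
      ext j; simp only [Finset.mem_filter, Finset.mem_univ, true_and, Finset.notMem_empty, iff_false]
      have := D.ct_le_three j; omega
    rw [e1, e2]

/-- The fibre equivalences of the design: `α⁻¹` on class 0, `γ` on class 1, `β` on class 2, counting above. -/
def fiberEquiv (k : ℕ) : {i : Fin r // D.rt i = k} ≃ {j : Fin r // D.ct j = k} :=
  if h0 : k = 0 then h0 ▸ D.fiber0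
  else if h1 : k = 1 then h1 ▸ D.fiber1
  else if h2 : k = 2 then h2 ▸ D.fiber2
  else Fintype.equivOfCardEq (D.card_fiber_ge_three (by omega))

/-- **The column permutation of the design.** -/
def κ : Fin r ≃ Fin r := Equiv.ofFiberEquiv (f := D.rt) (g := D.ct) D.fiberEquiv

/-- `ct (κ j) = rt j`. -/
theorem ct_κ (j : Fin r) : D.ct (D.κ j) = D.rt j := Equiv.ofFiberEquiv_map _ j

/-- `κ` on a class: the value of the chosen fibre equivalence. -/
theorem κ_eq (q : Fin r) : (D.κ q : Fin r) = (D.fiberEquiv (D.rt q) ⟨q, rfl⟩ : Fin r) :=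
  Equiv.ofFiberEquiv_apply D.fiberEquiv q

/-- On class 0 the permutation is `α⁻¹`. -/
theorem κ_of_zero {q : Fin r} (hq : D.rt q = 0) :
    (D.κ q : Fin r) = (D.α.symm ⟨q, (D.rt_eq_zero_iff q).mp hq⟩ : Fin r) := by
  have key : ∀ (k : ℕ) (hk : k = 0) (x : {i : Fin r // D.rt i = k}),
      (D.fiberEquiv k x : Fin r) = (D.α.symm ⟨x.1, (D.rt_eq_zero_iff x.1).mp (x.2.trans hk)⟩ : Fin r) := by
    intro k hk x; subst hk; rfl
  rw [D.κ_eq q, key (D.rt q) hq ⟨q, rfl⟩]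

/-- On class 1 the permutation is `γ`. -/
theorem κ_of_one {q : Fin r} (hq : D.rt q = 1) :
    (D.κ q : Fin r) = (D.γ ⟨q, (D.rt_eq_one_iff q).mp hq⟩ : Fin r) := by
  have key : ∀ (k : ℕ) (hk : k = 1) (x : {i : Fin r // D.rt i = k}),
      (D.fiberEquiv k x : Fin r) = (D.γ ⟨x.1, (D.rt_eq_one_iff x.1).mp (x.2.trans hk)⟩ : Fin r) := by
    intro k hk x; subst hk; rfl
  rw [D.κ_eq q, key (D.rt q) hq ⟨q, rfl⟩]

/-- On class 2 the permutation is `β`. -/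
theorem κ_of_two {q : Fin r} (hq : D.rt q = 2) :
    (D.κ q : Fin r) = (D.β ⟨q, (D.rt_eq_two_iff q).mp hq⟩ : Fin r) := by
  have key : ∀ (k : ℕ) (hk : k = 2) (x : {i : Fin r // D.rt i = k}),
      (D.fiberEquiv k x : Fin r) = (D.β ⟨x.1, (D.rt_eq_two_iff x.1).mp (x.2.trans hk)⟩ : Fin r) := by
    intro k hk x; subst hk; rfl
  rw [D.κ_eq q, key (D.rt q) hq ⟨q, rfl⟩]

end TCDesign

end Design

end StarDoor

end

end Summit.ValiantsHypothesis.ValiantsHypothesis.Theorems.BarrierLever.AnchoredPeeling
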